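import Literature.Geometry.Kaehler.ComplexTorusMixedHodgeIndexSemipositiveKernel
import HarnessLib

/-!
# The degree-two mixed Hodge index theorem in the CLOSURE of the cone: signature bounds for a SEMI-positive
# background on a complex torus, and the Hodge–Riemann locus (Dinh–Nguyên 2006, Prop. 4.1 / Remarks 4.2)

Layer `Literature/Geometry/Kaehler`, namespace `Literature.Geometry.Kaehler.ComplexTorus`; lane `lit-hodgefound`
(Track 2 foundations library, Layer A: Hodge theory of complex tori on invariant forms), seat p16, generation 23
(row g23-#5). Sequel of `ComplexTorusMixedHodgeIndexDegreeTwo` (row g22-#1: for a POSITIVE `(1,1)` background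
`𝒞` the mixed intersection form `Q = (· · · · 𝒞)` on `H²(X, ℝ)` has `(b⁺, b⁻) = (2·C(g,2) + 1, g² - 1)` and is
non-degenerate) and of `ComplexTorusMixedHodgeIndexSemipositiveKernel` (row g23-#4: for a SEMI-positive background
the radical of `Q` is described by Prop. 4.1, `Q ≥ 0` on `(H^{2,0} ⊕ H^{0,2})_ℝ`, `Q ≤ 0` on `h^⊥ ∩ H^{1,1}`).
Here the SIGNATURE of `Q` on `H²(X, ℝ)` in the closure of the cone, and Dinh–Nguyên's Hodge–Riemann locus
`𝒦̃^{HR}` versus the degeneracy locus `𝓛` in degree two on the invariant forms of a torus. THEOREMS ONLY: no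
definition, no named fact (net debt 0).

## Sources (verbatim, held copies)

* T.-C. Dinh, V.-A. Nguyên, *The mixed Hodge–Riemann bilinear relations for compact Kähler manifolds*, GAFA 16
  (2006) [DinhNguyen2006] (held `paper:arxiv-math_0501449`), p. 9: "Let `𝒦^{HR}_{n-p-q}` be the cone of all classes
  `[Ω] ∈ 𝒦_{n-p-q}` which satisfy the mixed Hodge–Riemann Theorem (Theorem A), that is, `Q(·,·)` is positive
  definite on `P^{p,q}(X)`. […] Let `𝓛_{n-2}` be the set of all classes `[Ω]` […] such that the wedge product map
  `[α] ↦ [α] ∧ [Ω]` does not induce an isomorphism between `H^{1,1}(X)` and `H^{n-1,n-1}(X)`. […]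
  **Proposition 4.1.** The cone `𝒦^{HR}_{n-2}` is a union of connected components of `𝒦_{n-2} ∖ 𝓛_{n-2}`. […]
  Moreover, if `[Ω]` is a class in `𝒦̄^{HR}_{n-2}` then `Q(·,·)` is positive semi-definite on `P^{1,1}(X)` […]
  Proof. It is clear that `𝓛_{n-2} ∩ 𝒦^{HR}_{n-2} = ∅`. […] By continuity, `Q(·,·)` is positive semi-definite on
  `P^{1,1}(X)`. […] **Remarks 4.2.** Observe that `Q(·,·)` is positive definite on `H^{2,0}(X) ⊕ H^{0,2}(X)` for
  `Ω ∈ 𝒦_{n-2}`. Then if `[Ω] ∈ 𝒦^{HR}_{n-2}`, the multiplication by `[Ω]` induces an isomorphism between `H²(X)`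
  and `H^{n-2}(X)`. Let `𝒦̃_{n-2}` be the cone of the classes […] of all positive closed currents of bidegree
  `(n-2,n-2)`. […] Then Proposition 4.1 holds for `𝒦̃^{HR}_{n-2}`."
* Y. Shenfeld, R. van Handel, *Mixed volumes and the Bochner method* (2019) [ShenfeldVanHandel2019] (held
  `paper:arxiv-1811.08710`), p. 4 Lemma 1.4 (ii) ("The positive eigenspace of `A` has dimension at most one") and
  §2.4 Lemma 2.9 (index from hyperbolicity) — tree: `sigPos_le_one_of_orthogonal_nonpos`,
  `sigPos_eq_one_of_orthogonal_nonpos`, `QuadraticForm.sigPos_add_finrank_le_of_nonpos` (Sylvester).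
* D. Huybrechts, *Complex Geometry* (2005) [Huybrechts2005], Cor. 3.3.16 (the index `(2h^{2,0} + 1, h^{1,1} - 1)`
  of the Hodge–Riemann pairing on `H²` of a compact Kähler manifold, via the orthogonal splitting
  `H²(X, ℝ) = ((H^{2,0} ⊕ H^{0,2}) ∩ H²(X, ℝ)) ⊕ H^{1,1}(X, ℝ)`).

## What is proved

`X = E/Φ(ℤ^ι)` a complex torus of dimension `g ≥ 2` (`e : Fin (2g) ≃ ι`), two slots `j₁ ≠ j₂`, a family `η`
whose BACKGROUND `𝒞 = (η_j)_{j ≠ j₁, j₂}` consists of SEMI-positive `(1,1)`-forms (`hpsd`; on the torus these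
represent the invariant part of Dinh–Nguyên's closed cone `𝒦̃_{n-2} ⊇ 𝒦_{n-2}`), `Q = mixedIntersectionForm Φ e η hne`
on `H²(X, ℝ)` (`dim = C(2g, 2) = 2·C(g,2) + g²`), `W = H^{1,1}(X, ℝ) = realOneOneForms E` (`dim g²`).

1. **Signature bounds in the closure of the cone** (§1): `b⁺(Q) ≤ 2·C(g,2) + 1`
   (`sigPos_mixedIntersectionForm_le_of_semipos`; `≤ 2·C(g,2)` if `Q ≤ 0` on `W`), `b⁻(Q) ≤ g²`
   (`sigNeg_mixedIntersectionForm_le_of_semipos`), `b⁻(Q) ≤ g² - 1` as soon as some non-zero `h ∈ W` has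
   `(h · h · 𝒞) ≥ 0` (`sigNeg_mixedIntersectionForm_le_of_self_nonneg_of_semipos`); on `W`:
   `b⁺(Q|W) = 1` whenever some `h ∈ W` has `(h · h · 𝒞) > 0` (`sigPos_mixedIntersectionForm_restrict_realOneOneForms_eq_one_of_semipos`).
   Tools: the `h`-primitive hyperplane `W ∩ h^⊥` has dimension `≥ g² - 1` and `Q ≤ 0` there; `Q ≥ 0` on
   `ℝh ⊕ (H^{2,0} ⊕ H^{0,2})_ℝ` (dimension `2·C(g,2) + 1`).
2. **The Hodge–Riemann locus** (§2, "`[Ω] ∈ 𝒦̃^{HR}`": `(c · c · 𝒞) < 0` for `0 ≠ c ∈ W ∩ h^⊥`, `(h · h · 𝒞) > 0`):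
   `(b⁺, b⁻)(Q|W) = (1, g² - 1)` (`sigNeg_mixedIntersectionForm_restrict_realOneOneForms_eq_of_HR`); if moreover
   `Q > 0` on `(H^{2,0} ⊕ H^{0,2})_ℝ ∖ 0` then `(b⁺, b⁻)(Q) = (2·C(g,2) + 1, g² - 1)`, the radical is trivial and
   `Q` is NON-DEGENERATE on `H²(X, ℝ)` (`sigPos_sigNeg_mixedIntersectionForm_of_HR`,
   `nondegenerate_mixedIntersectionForm_of_HR` — Remarks 4.2 "the multiplication by `[Ω]` induces an isomorphism
   between `H²(X)` and `H^{2n-2}(X)`" in Poincaré-dual form, for the closed cone).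
3. **`𝓛 ∩ 𝒦̃^{HR} = ∅` and its converse in degree two** (§3): for a semi-positive background with a class `h ∈ W`
   of positive mixed square, `Q` is non-degenerate on `H²(X, ℝ)` **iff** the Hodge–Riemann property holds on `W`
   AND `Q > 0` on `(H^{2,0} ⊕ H^{0,2})_ℝ ∖ 0` (`nondegenerate_mixedIntersectionForm_iff_of_semipos`), iff
   `(b⁺, b⁻)(Q) = (2·C(g,2) + 1, g² - 1)` (`nondegenerate_mixedIntersectionForm_iff_sigPos_sigNeg_of_semipos`).

NOT claimed: the openness / connected-components clause of Prop. 4.1 (a statement about the cone of a general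
compact Kähler manifold), currents, the operator (non-Poincaré-dual) form of Remarks 4.2.
-/

noncomputable section

set_option maxSynthPendingDepth 3

open scoped ComplexOrder ComplexConjugate
open Module Complex Function QuadraticMap
open Literature.LinearAlgebra.QuadraticForm
open Literature.Geometry.Hyperkaehler.ComplexTorus (realTwoZeroForms realTwoZeroForms_sup_realOneOneForms
  disjoint_span_realTwoZeroForms_of_mem_realOneOneForms)

namespace Literature.Geometry.Kaehler

namespace ComplexTorus

variable {ι : Type*} [Fintype ι] [DecidableEq ι] {E : Type*} [NormedAddCommGroup E] [NormedSpace ℂ E]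
  (Φ : (ι → ℝ) ≃L[ℝ] E) {g : ℕ} {η : Fin g → E [⋀^Fin 2]→L[ℝ] ℝ} {j₁ j₂ : Fin g}

/-! ## §0 Arithmetic of the Hodge numbers `b₂ = C(2g,2) = 2·C(g,2) + g²` -/

/-- `2·C(m, 2) + m = m²`. [folklore] -/
private theorem two_mul_choose_two_add_eq' (m : ℕ) : 2 * m.choose 2 + m = m * m := by
  rw [Nat.choose_two_right, Nat.two_mul_div_two_of_even (Nat.even_mul_pred_self m)]
  cases m with
  | zero => simp
  | succ n => rw [Nat.succ_sub_one]; ring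

/-- `C(2m, 2) = 2·C(m, 2) + m²`. [folklore] -/
private theorem choose_two_mul_two_eq' (m : ℕ) : (2 * m).choose 2 = 2 * m.choose 2 + m * m := by
  have h1 := two_mul_choose_two_add_eq' m
  have h2 := two_mul_choose_two_add_eq' (2 * m)
  have h3 : 2 * m * (2 * m) = 4 * (m * m) := by ring
  omega

omit [NormedSpace ℂ E] in
/-- Two distinct slots force `2 ≤ g`. [folklore] -/
private theorem two_le_of_ne' (hne : j₁ ≠ j₂) : 2 ≤ g := by
  have h1 := j₁.is_lt
  by_contra hlt
  have : g = 1 := by omega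
  subst this
  exact hne (Subsingleton.elim _ _)

/-- The restricted bilinear form and the restricted quadratic form agree. [folklore] -/
private theorem toQuadraticMap_restrict'' {V : Type*} [AddCommGroup V] [Module ℝ V] (B : LinearMap.BilinForm ℝ V)
    (W : Submodule ℝ V) : (B.restrict W).toQuadraticMap = B.toQuadraticMap.restrict W :=
  QuadraticMap.ext fun _ ↦ rfl

/-! ## §1 Signature bounds for a semi-positive background (the closure `𝒦̄`, `𝒦̃` of the cone) -/

section Bounds

/-- **The `h`-primitive hyperplane of `H^{1,1}(X, ℝ)` has dimension `≥ g² - 1`**: `dim (W ∩ h^⊥) + 1 ≥ g²` for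
`W = H^{1,1}(X, ℝ)` and `h^⊥ = ker (b ↦ (b · h · 𝒞))` ("`P^{1,1}(X)` is a hyperplane of `H^{1,1}(X)`", here without
any non-degeneracy: at least a hyperplane). [cite: DinhNguyen2006, §4 before Proposition 4.1 (arXiv PDF p. 9)]
[cite: Huybrechts2005, Cor. 3.3.16] -/
theorem le_finrank_realOneOneForms_inf_ker_add_one (e : Fin (2 * g) ≃ ι) (hne : j₁ ≠ j₂)
    (h : E [⋀^Fin 2]→L[ℝ] ℝ) :
    g * g ≤ finrank ℝ (realOneOneForms E ⊓ LinearMap.ker ((mixedIntersectionForm Φ e η hne).flip h) :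
      Submodule ℝ (E [⋀^Fin 2]→L[ℝ] ℝ)) + 1 := by
  have hg : 2 ≤ g := two_le_of_ne' hne
  haveI := finiteDimensional_realForms Φ e (k := 2) (by omega)
  set K := LinearMap.ker ((mixedIntersectionForm Φ e η hne).flip h) with hK
  have h1 := ((mixedIntersectionForm Φ e η hne).flip h).finrank_range_add_finrank_ker
  have h2 : finrank ℝ (LinearMap.range ((mixedIntersectionForm Φ e η hne).flip h)) ≤ 1 :=
    (Submodule.finrank_le _).trans (finrank_self ℝ).le
  have h3 := Submodule.finrank_sup_add_finrank_inf_eq (realOneOneForms E) K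
  have h4 := Submodule.finrank_le (realOneOneForms E ⊔ K)
  rw [finrank_realOneOneForms Φ e (by omega)] at h3
  rw [← hK] at h1
  omega

/-- **`(· · · · 𝒞) ≤ 0` on the `h`-primitive hyperplane `W ∩ h^⊥`** for a semi-positive background and
`(h · h · 𝒞) > 0` ("By continuity, `Q(·,·)` is positive semi-definite on `P^{1,1}(X)`", intersection sign
convention). [cite: DinhNguyen2006, §4 Proposition 4.1 (arXiv PDF p. 9)] [cite: ShenfeldVanHandel2019, §1.2 Lemma 1.4 (arXiv p. 4)] -/
theorem mixedIntersectionForm_toQuadraticMap_nonpos_of_mem_inf_ker_of_semipos (e : Fin (2 * g) ≃ ι)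
    (h11 : ∀ j, j ≠ j₁ → j ≠ j₂ → ∀ x y : E, η j ![I • x, I • y] = η j ![x, y]) (hne : j₁ ≠ j₂)
    (hpsd : ∀ j, j ≠ j₁ → j ≠ j₂ → ∀ v : E, 0 ≤ η j ![I • v, v])
    {h : E [⋀^Fin 2]→L[ℝ] ℝ} (hh : h ∈ realOneOneForms E) (hh0 : 0 < mixedIntersectionForm Φ e η hne h h)
    {x : E [⋀^Fin 2]→L[ℝ] ℝ}
    (hx : x ∈ (realOneOneForms E ⊓ LinearMap.ker ((mixedIntersectionForm Φ e η hne).flip h) :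
      Submodule ℝ (E [⋀^Fin 2]→L[ℝ] ℝ))) :
    (mixedIntersectionForm Φ e η hne).toQuadraticMap x ≤ 0 := by
  rw [LinearMap.BilinMap.toQuadraticMap_apply]
  have hx2 : mixedIntersectionForm Φ e η hne x h = 0 := by
    have := LinearMap.mem_ker.1 (Submodule.mem_inf.1 hx).2
    rwa [LinearMap.BilinForm.flip_apply] at this
  exact mixedIntersectionForm_self_nonpos_of_orthogonal_of_semipos Φ e h11 hne hpsd hh (Submodule.mem_inf.1 hx).1
    hh0 hx2

/-- **`b⁺((· · · · 𝒞)) ≤ 2·C(g, 2)` when `(· · · · 𝒞) ≤ 0` on all of `H^{1,1}(X, ℝ)`** (a non-positive subspace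
of dimension `g²` inside `H²(X, ℝ)` of dimension `2·C(g,2) + g²`; Sylvester). [cite: Huybrechts2005, Cor. 3.3.16]
[cite: ShenfeldVanHandel2019, §2.4 Lemma 2.9 (arXiv pp. 7–8)] -/
theorem sigPos_mixedIntersectionForm_le_of_forall_nonpos (e : Fin (2 * g) ≃ ι) (hne : j₁ ≠ j₂)
    (hW : ∀ x ∈ realOneOneForms E, mixedIntersectionForm Φ e η hne x x ≤ 0) :
    sigPos (mixedIntersectionForm Φ e η hne).toQuadraticMap ≤ 2 * g.choose 2 := by
  have hg : 2 ≤ g := two_le_of_ne' hne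
  haveI := finiteDimensional_realForms Φ e (k := 2) (by omega)
  have h1 := QuadraticForm.sigPos_add_finrank_le_of_nonpos (Q := (mixedIntersectionForm Φ e η hne).toQuadraticMap)
    (V := realOneOneForms E) fun x hx ↦ by
      rw [LinearMap.BilinMap.toQuadraticMap_apply]; exact hW x hx
  rw [finrank_realOneOneForms Φ e (by omega), finrank_realForms_eq_choose Φ e 2, choose_two_mul_two_eq'] at h1
  omega

/-- **`b⁺((· · · · 𝒞)) ≤ 2·C(g, 2) + 1 = 2h^{2,0}(X) + 1` on `H²(X, ℝ)` for every SEMI-positive background** (the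
positive index of the closed cone `𝒦̃_{n-2}` is at most that of the open cone, `sigPos_mixedIntersectionForm` of
`ComplexTorusMixedHodgeIndexDegreeTwo`): either some `h ∈ H^{1,1}(X, ℝ)` has `(h · h · 𝒞) > 0`, and then the
`h`-primitive hyperplane (dimension `≥ g² - 1`) is non-positive, or `(· · · · 𝒞) ≤ 0` on all of `H^{1,1}(X, ℝ)`.
[cite: DinhNguyen2006, §4 Proposition 4.1 and Remarks 4.2 (arXiv PDF p. 9)] [cite: Huybrechts2005, Cor. 3.3.16]
[cite: ShenfeldVanHandel2019, §1.2 Lemma 1.4 (ii) (arXiv p. 4)] -/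
theorem sigPos_mixedIntersectionForm_le_of_semipos (e : Fin (2 * g) ≃ ι)
    (h11 : ∀ j, j ≠ j₁ → j ≠ j₂ → ∀ x y : E, η j ![I • x, I • y] = η j ![x, y]) (hne : j₁ ≠ j₂)
    (hpsd : ∀ j, j ≠ j₁ → j ≠ j₂ → ∀ v : E, 0 ≤ η j ![I • v, v]) :
    sigPos (mixedIntersectionForm Φ e η hne).toQuadraticMap ≤ 2 * g.choose 2 + 1 := by
  have hg : 2 ≤ g := two_le_of_ne' hne
  haveI := finiteDimensional_realForms Φ e (k := 2) (by omega)
  by_cases hex : ∃ h ∈ realOneOneForms E, 0 < mixedIntersectionForm Φ e η hne h h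
  · obtain ⟨h, hh, hh0⟩ := hex
    have h1 := QuadraticForm.sigPos_add_finrank_le_of_nonpos
      (Q := (mixedIntersectionForm Φ e η hne).toQuadraticMap)
      (V := realOneOneForms E ⊓ LinearMap.ker ((mixedIntersectionForm Φ e η hne).flip h)) fun x hx ↦
        mixedIntersectionForm_toQuadraticMap_nonpos_of_mem_inf_ker_of_semipos Φ e h11 hne hpsd hh hh0 hx
    have h2 := le_finrank_realOneOneForms_inf_ker_add_one Φ e hne h (η := η)
    rw [finrank_realForms_eq_choose Φ e 2, choose_two_mul_two_eq'] at h1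
    have h5 : 1 ≤ g * g := le_trans (by norm_num) (Nat.mul_le_mul hg hg)
    omega
  · push Not at hex
    exact (sigPos_mixedIntersectionForm_le_of_forall_nonpos Φ e hne hex).trans (Nat.le_succ _)

/-- **`b⁻((· · · · 𝒞)) ≤ g² = h^{1,1}(X)` on `H²(X, ℝ)` for every SEMI-positive background**: `(· · · · 𝒞) ≥ 0` on
`(H^{2,0} ⊕ H^{0,2})_ℝ` (dimension `2·C(g,2)`; `mixedIntersectionForm_self_nonneg_of_mem_realTwoZeroForms_of_semipos`).
[cite: DinhNguyen2006, §4 Remarks 4.2 (arXiv PDF p. 9)] [cite: Huybrechts2005, Cor. 3.3.16] -/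
theorem sigNeg_mixedIntersectionForm_le_of_semipos (e : Fin (2 * g) ≃ ι)
    (h11 : ∀ j, j ≠ j₁ → j ≠ j₂ → ∀ x y : E, η j ![I • x, I • y] = η j ![x, y]) (hne : j₁ ≠ j₂)
    (hpsd : ∀ j, j ≠ j₁ → j ≠ j₂ → ∀ v : E, 0 ≤ η j ![I • v, v]) :
    sigNeg (mixedIntersectionForm Φ e η hne).toQuadraticMap ≤ g * g := by
  have hg : 2 ≤ g := two_le_of_ne' hne
  haveI := finiteDimensional_realForms Φ e (k := 2) (by omega)
  have h1 := QuadraticForm.sigPos_add_finrank_le_of_nonpos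
    (Q := -(mixedIntersectionForm Φ e η hne).toQuadraticMap) (V := realTwoZeroForms E) fun x hx ↦ by
      rw [QuadraticMap.neg_apply, neg_nonpos, LinearMap.BilinMap.toQuadraticMap_apply]
      exact mixedIntersectionForm_self_nonneg_of_mem_realTwoZeroForms_of_semipos Φ e h11 hne hpsd hx
  rw [sigPos_neg, finrank_realTwoZeroForms_eq_two_mul_choose Φ e (by omega), finrank_realForms_eq_choose Φ e 2,
    choose_two_mul_two_eq'] at h1
  omega

/-- **`(· · · · 𝒞) ≥ 0` on `ℝh ⊕ (H^{2,0} ⊕ H^{0,2})_ℝ` for a semi-positive background and `h ∈ H^{1,1}(X, ℝ)` with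
`(h · h · 𝒞) ≥ 0`**: `(th + α · th + α · 𝒞) = t²(h · h · 𝒞) + (α · α · 𝒞)`, the cross terms vanishing by the
orthogonal splitting. [cite: Huybrechts2005, Cor. 3.3.16 (proof)] [cite: DinhNguyen2006, §4 Remarks 4.2 (arXiv PDF p. 9)] -/
theorem mixedIntersectionForm_toQuadraticMap_nonneg_of_mem_span_sup_realTwoZeroForms_of_semipos
    (e : Fin (2 * g) ≃ ι) (h11 : ∀ j, j ≠ j₁ → j ≠ j₂ → ∀ x y : E, η j ![I • x, I • y] = η j ![x, y])
    (hne : j₁ ≠ j₂) (hpsd : ∀ j, j ≠ j₁ → j ≠ j₂ → ∀ v : E, 0 ≤ η j ![I • v, v])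
    {h : E [⋀^Fin 2]→L[ℝ] ℝ} (hh : h ∈ realOneOneForms E) (hh0 : 0 ≤ mixedIntersectionForm Φ e η hne h h)
    {x : E [⋀^Fin 2]→L[ℝ] ℝ} (hx : x ∈ ((ℝ ∙ h) ⊔ realTwoZeroForms E : Submodule ℝ _)) :
    0 ≤ (mixedIntersectionForm Φ e η hne).toQuadraticMap x := by
  obtain ⟨y, hy, α, hα, rfl⟩ := Submodule.mem_sup.1 hx
  obtain ⟨t, rfl⟩ := Submodule.mem_span_singleton.1 hy
  rw [LinearMap.BilinMap.toQuadraticMap_apply]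
  have hcross : mixedIntersectionForm Φ e η hne h α = 0 :=
    mixedIntersectionForm_eq_zero_of_mem_realTwoZeroForms_right Φ e h11 hne hα hh
  have hcross' : mixedIntersectionForm Φ e η hne α h = 0 :=
    mixedIntersectionForm_eq_zero_of_mem_realTwoZeroForms_left Φ e h11 hne hα hh
  have hexp : mixedIntersectionForm Φ e η hne (t • h + α) (t • h + α) =
      t * t * mixedIntersectionForm Φ e η hne h h + mixedIntersectionForm Φ e η hne α α := by
    simp only [map_add, map_smul, LinearMap.add_apply, LinearMap.smul_apply, smul_eq_mul, hcross, hcross']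
    ring
  rw [hexp]
  exact add_nonneg (mul_nonneg (mul_self_nonneg t) hh0)
    (mixedIntersectionForm_self_nonneg_of_mem_realTwoZeroForms_of_semipos Φ e h11 hne hpsd hα)

/-- **`b⁻((· · · · 𝒞)) ≤ g² - 1 = h^{1,1}(X) - 1` for a semi-positive background as soon as some non-zero
`h ∈ H^{1,1}(X, ℝ)` has `(h · h · 𝒞) ≥ 0`** (the non-negative subspace `ℝh ⊕ (H^{2,0} ⊕ H^{0,2})_ℝ` has
dimension `2·C(g,2) + 1`). [cite: DinhNguyen2006, §4 Remarks 4.2 (arXiv PDF p. 9)] [cite: Huybrechts2005, Cor. 3.3.16] -/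
theorem sigNeg_mixedIntersectionForm_le_of_self_nonneg_of_semipos (e : Fin (2 * g) ≃ ι)
    (h11 : ∀ j, j ≠ j₁ → j ≠ j₂ → ∀ x y : E, η j ![I • x, I • y] = η j ![x, y]) (hne : j₁ ≠ j₂)
    (hpsd : ∀ j, j ≠ j₁ → j ≠ j₂ → ∀ v : E, 0 ≤ η j ![I • v, v])
    {h : E [⋀^Fin 2]→L[ℝ] ℝ} (hh : h ∈ realOneOneForms E) (hh0 : h ≠ 0)
    (hhnn : 0 ≤ mixedIntersectionForm Φ e η hne h h) :
    sigNeg (mixedIntersectionForm Φ e η hne).toQuadraticMap ≤ g * g - 1 := by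
  have hg : 2 ≤ g := two_le_of_ne' hne
  haveI := finiteDimensional_realForms Φ e (k := 2) (by omega)
  have h1 := QuadraticForm.sigPos_add_finrank_le_of_nonpos
    (Q := -(mixedIntersectionForm Φ e η hne).toQuadraticMap) (V := (ℝ ∙ h) ⊔ realTwoZeroForms E) fun x hx ↦ by
      rw [QuadraticMap.neg_apply, neg_nonpos]
      exact mixedIntersectionForm_toQuadraticMap_nonneg_of_mem_span_sup_realTwoZeroForms_of_semipos Φ e h11 hne
        hpsd hh hhnn hx
  rw [sigPos_neg, finrank_span_sup_realTwoZeroForms_eq Φ e (by omega) hh hh0, finrank_realForms_eq_choose Φ e 2,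
    choose_two_mul_two_eq'] at h1
  have h5 : 1 ≤ g * g := le_trans (by norm_num) (Nat.mul_le_mul hg hg)
  omega

/-- **`b⁺((· · · · 𝒞)|H^{1,1}) = 1` for a semi-positive background with a class `h ∈ H^{1,1}(X, ℝ)` of positive
mixed square** (index from hyperbolicity: `h` is timelike and `h^⊥` is non-positive — the tree's
`sigPos_eq_one_of_orthogonal_nonpos`; for positive backgrounds this is `sigPos_mixedIntersectionForm_restrict_realOneOneForms`).
[cite: ShenfeldVanHandel2019, §1.2 Lemma 1.4 (ii) and §2.4 Lemma 2.9 (arXiv pp. 4, 7–8)] [cite: DinhNguyen2006, §4 Proposition 4.1 (arXiv PDF p. 9)] -/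
theorem sigPos_mixedIntersectionForm_restrict_realOneOneForms_eq_one_of_semipos (e : Fin (2 * g) ≃ ι)
    (h11 : ∀ j, j ≠ j₁ → j ≠ j₂ → ∀ x y : E, η j ![I • x, I • y] = η j ![x, y]) (hne : j₁ ≠ j₂)
    (hpsd : ∀ j, j ≠ j₁ → j ≠ j₂ → ∀ v : E, 0 ≤ η j ![I • v, v])
    {h : E [⋀^Fin 2]→L[ℝ] ℝ} (hh : h ∈ realOneOneForms E) (hh0 : 0 < mixedIntersectionForm Φ e η hne h h) :
    sigPos ((mixedIntersectionForm Φ e η hne).toQuadraticMap.restrict (realOneOneForms E)) = 1 := by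
  have hg : 2 ≤ g := two_le_of_ne' hne
  haveI := finiteDimensional_realForms Φ e (k := 2) (by omega)
  rw [← toQuadraticMap_restrict'']
  exact sigPos_eq_one_of_orthogonal_nonpos _ (w := ⟨h, hh⟩) hh0 fun z hz ↦
    mixedIntersectionForm_self_nonpos_of_orthogonal_of_semipos Φ e h11 hne hpsd hh z.2 hh0 hz

/-- **`IsRiemannForm` reading**: for a polarisation `L` with `(L · L · 𝒞) > 0` against a semi-positive background,
`(· · · · 𝒞)|H^{1,1}` has exactly one positive square. [cite: ShenfeldVanHandel2019, §1.2 Lemma 1.4 (ii) (arXiv p. 4)]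
[cite: Lange2023AbelianVarietiesComplex, §5.1.2 (p. 244)] -/
theorem IsRiemannForm.sigPos_mixedIntersectionForm_restrict_eq_one_of_semipos (e : Fin (2 * g) ≃ ι)
    (h11 : ∀ j, j ≠ j₁ → j ≠ j₂ → ∀ x y : E, η j ![I • x, I • y] = η j ![x, y]) (hne : j₁ ≠ j₂)
    (hpsd : ∀ j, j ≠ j₁ → j ≠ j₂ → ∀ v : E, 0 ≤ η j ![I • v, v]) {L : E [⋀^Fin 2]→L[ℝ] ℝ}
    (hL : IsRiemannForm Φ L) (hL0 : 0 < mixedIntersectionForm Φ e η hne L L) :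
    sigPos ((mixedIntersectionForm Φ e η hne).toQuadraticMap.restrict (realOneOneForms E)) = 1 :=
  ComplexTorus.sigPos_mixedIntersectionForm_restrict_realOneOneForms_eq_one_of_semipos Φ e h11 hne hpsd
    (mem_realOneOneForms_of_I_smul hL.1) hL0

end Bounds

/-! ## §2 The Hodge–Riemann locus `𝒦̃^{HR}`: signature `(1, g² - 1)` on `H^{1,1}`, `(2·C(g,2) + 1, g² - 1)` on `H²` -/

section HRLocus

/-- **On the Hodge–Riemann locus `b⁻((· · · · 𝒞)|H^{1,1}) = g² - 1`**: if `(h · h · 𝒞) > 0` and `(c · c · 𝒞) < 0`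
for every `0 ≠ c ∈ H^{1,1}(X, ℝ)` with `(c · h · 𝒞) = 0` (the background is in `𝒦̃^{HR}`), then the `h`-primitive
hyperplane is negative definite of dimension `g² - 1` and `b⁺ = 1` ("`Q(·,·)` is positive definite on
`P^{1,1}(X)`", intersection sign convention). [cite: DinhNguyen2006, §4 Proposition 4.1 and §1 Theorem 1.3 (arXiv PDF pp. 9, 3)]
[cite: Huybrechts2005, Cor. 3.3.16] -/
theorem sigNeg_mixedIntersectionForm_restrict_realOneOneForms_eq_of_HR (e : Fin (2 * g) ≃ ι)
    (h11 : ∀ j, j ≠ j₁ → j ≠ j₂ → ∀ x y : E, η j ![I • x, I • y] = η j ![x, y]) (hne : j₁ ≠ j₂)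
    (hpsd : ∀ j, j ≠ j₁ → j ≠ j₂ → ∀ v : E, 0 ≤ η j ![I • v, v])
    {h : E [⋀^Fin 2]→L[ℝ] ℝ} (hh : h ∈ realOneOneForms E) (hh0 : 0 < mixedIntersectionForm Φ e η hne h h)
    (hHR : ∀ c ∈ realOneOneForms E, c ≠ 0 → mixedIntersectionForm Φ e η hne c h = 0 →
      mixedIntersectionForm Φ e η hne c c < 0) :
    sigNeg ((mixedIntersectionForm Φ e η hne).toQuadraticMap.restrict (realOneOneForms E)) = g * g - 1 := by
  have hg : 2 ≤ g := two_le_of_ne' hne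
  haveI := finiteDimensional_realForms Φ e (k := 2) (by omega)
  set QW := (mixedIntersectionForm Φ e η hne).toQuadraticMap.restrict (realOneOneForms E) with hQW
  -- the `h`-primitive hyperplane inside `W`, as the kernel of `b ↦ (b · h · 𝒞)` on `W`
  set ℓ : realOneOneForms E →ₗ[ℝ] ℝ :=
    ((mixedIntersectionForm Φ e η hne).flip h).comp (realOneOneForms E).subtype with hℓ
  have hker : ∀ z : realOneOneForms E, z ∈ LinearMap.ker ℓ ↔ mixedIntersectionForm Φ e η hne z h = 0 := by
    intro z
    rw [LinearMap.mem_ker, hℓ, LinearMap.comp_apply, Submodule.subtype_apply, LinearMap.BilinForm.flip_apply]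
  -- it is negative definite
  have hN : ((-QW).restrict (LinearMap.ker ℓ)).PosDef := by
    intro x hx
    have hx0 : ((x : realOneOneForms E) : E [⋀^Fin 2]→L[ℝ] ℝ) ≠ 0 := fun h0 ↦
      hx (Subtype.ext (Subtype.ext h0))
    rw [QuadraticMap.restrict_apply, QuadraticMap.neg_apply, hQW, QuadraticMap.restrict_apply,
      LinearMap.BilinMap.toQuadraticMap_apply, neg_pos]
    exact hHR _ (x : realOneOneForms E).2 hx0 ((hker _).1 x.2)
  -- of dimension `≥ g² - 1`
  have hdim : g * g ≤ finrank ℝ (LinearMap.ker ℓ) + 1 := by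
    have h1 := ℓ.finrank_range_add_finrank_ker
    have h2 : finrank ℝ (LinearMap.range ℓ) ≤ 1 := (Submodule.finrank_le _).trans (finrank_self ℝ).le
    rw [finrank_realOneOneForms Φ e (by omega)] at h1
    omega
  have hle := le_sigNeg_of_negDef QW hN
  -- `b⁺ = 1` and Sylvester's count on `W`
  have hpos : sigPos QW = 1 :=
    sigPos_mixedIntersectionForm_restrict_realOneOneForms_eq_one_of_semipos Φ e h11 hne hpsd hh hh0
  have h3 := QuadraticForm.sigPos_add_sigNeg_add_radical (Q := QW)
  rw [finrank_realOneOneForms Φ e (by omega), hpos] at h3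
  omega

/-- **On the Hodge–Riemann locus `(b⁺, b⁻)((· · · · 𝒞)|H^{1,1}) = (1, g² - 1) = (1, h^{1,1}(X) - 1)`** — the mixed
Hodge index theorem on `H^{1,1}(X, ℝ)` (the tree's `sigPos_/sigNeg_mixedIntersectionForm_restrict_realOneOneForms`
for positive backgrounds) holds verbatim for every semi-positive background with the Hodge–Riemann property.
[cite: DinhNguyen2006, §4 Proposition 4.1 and §1 Theorem 1.3 (arXiv PDF pp. 9, 3)] [cite: Huybrechts2005, Cor. 3.3.16] -/
theorem sigPos_sigNeg_mixedIntersectionForm_restrict_realOneOneForms_of_HR (e : Fin (2 * g) ≃ ι)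
    (h11 : ∀ j, j ≠ j₁ → j ≠ j₂ → ∀ x y : E, η j ![I • x, I • y] = η j ![x, y]) (hne : j₁ ≠ j₂)
    (hpsd : ∀ j, j ≠ j₁ → j ≠ j₂ → ∀ v : E, 0 ≤ η j ![I • v, v])
    {h : E [⋀^Fin 2]→L[ℝ] ℝ} (hh : h ∈ realOneOneForms E) (hh0 : 0 < mixedIntersectionForm Φ e η hne h h)
    (hHR : ∀ c ∈ realOneOneForms E, c ≠ 0 → mixedIntersectionForm Φ e η hne c h = 0 →
      mixedIntersectionForm Φ e η hne c c < 0) :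
    sigPos ((mixedIntersectionForm Φ e η hne).toQuadraticMap.restrict (realOneOneForms E)) = 1 ∧
      sigNeg ((mixedIntersectionForm Φ e η hne).toQuadraticMap.restrict (realOneOneForms E)) = g * g - 1 :=
  ⟨sigPos_mixedIntersectionForm_restrict_realOneOneForms_eq_one_of_semipos Φ e h11 hne hpsd hh hh0,
    sigNeg_mixedIntersectionForm_restrict_realOneOneForms_eq_of_HR Φ e h11 hne hpsd hh hh0 hHR⟩

/-- **`(· · · · 𝒞)` is positive definite on `ℝh ⊕ (H^{2,0} ⊕ H^{0,2})_ℝ`** when `(h · h · 𝒞) > 0`, `h ∈ H^{1,1}(X, ℝ)`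
and `(· · · · 𝒞) > 0` on `(H^{2,0} ⊕ H^{0,2})_ℝ ∖ 0` (Remarks 4.2 for `Ω ∈ 𝒦_{n-2}`; here as a hypothesis on the
closed cone). [cite: DinhNguyen2006, §4 Remarks 4.2 (arXiv PDF p. 9)] [cite: Huybrechts2005, Cor. 3.3.16 (proof)] -/
theorem posDef_mixedIntersectionForm_restrict_span_sup_realTwoZeroForms_of_self_pos (e : Fin (2 * g) ≃ ι)
    (h11 : ∀ j, j ≠ j₁ → j ≠ j₂ → ∀ x y : E, η j ![I • x, I • y] = η j ![x, y]) (hne : j₁ ≠ j₂)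
    {h : E [⋀^Fin 2]→L[ℝ] ℝ} (hh : h ∈ realOneOneForms E) (hh0 : 0 < mixedIntersectionForm Φ e η hne h h)
    (h20 : ∀ a ∈ realTwoZeroForms E, a ≠ 0 → 0 < mixedIntersectionForm Φ e η hne a a) :
    (((mixedIntersectionForm Φ e η hne).toQuadraticMap).restrict ((ℝ ∙ h) ⊔ realTwoZeroForms E)).PosDef := by
  rintro ⟨x, hx⟩ hx0
  obtain ⟨y, hy, α, hα, rfl⟩ := Submodule.mem_sup.1 hx
  obtain ⟨t, rfl⟩ := Submodule.mem_span_singleton.1 hy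
  rw [QuadraticMap.restrict_apply, LinearMap.BilinMap.toQuadraticMap_apply]
  change 0 < mixedIntersectionForm Φ e η hne (t • h + α) (t • h + α)
  have hcross : mixedIntersectionForm Φ e η hne h α = 0 :=
    mixedIntersectionForm_eq_zero_of_mem_realTwoZeroForms_right Φ e h11 hne hα hh
  have hcross' : mixedIntersectionForm Φ e η hne α h = 0 :=
    mixedIntersectionForm_eq_zero_of_mem_realTwoZeroForms_left Φ e h11 hne hα hh
  have hexp : mixedIntersectionForm Φ e η hne (t • h + α) (t • h + α) =
      t * t * mixedIntersectionForm Φ e η hne h h + mixedIntersectionForm Φ e η hne α α := by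
    simp only [map_add, map_smul, LinearMap.add_apply, LinearMap.smul_apply, smul_eq_mul, hcross, hcross']
    ring
  rw [hexp]
  rcases eq_or_ne α 0 with rfl | hα0
  · have ht : t ≠ 0 := by
      rintro rfl
      exact hx0 (by ext1; simp)
    rw [LinearMap.map_zero₂, add_zero]
    exact mul_pos (mul_self_pos.2 ht) hh0
  · exact add_pos_of_nonneg_of_pos (mul_nonneg (mul_self_nonneg t) hh0.le) (h20 α hα hα0)

/-- The three Sylvester numbers on the Hodge–Riemann locus: `b⁺ = 2·C(g,2) + 1`, `b⁻ = g² - 1`, `dim rad = 0`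
(a positive definite `ℝh ⊕ (H^{2,0} ⊕ H^{0,2})_ℝ`, a negative definite `h`-primitive hyperplane of dimension
`≥ g² - 1`, and `b⁺ + b⁻ + dim rad = C(2g,2) = 2·C(g,2) + g²`). [folklore] -/
private theorem index_aux_HR (e : Fin (2 * g) ≃ ι)
    (h11 : ∀ j, j ≠ j₁ → j ≠ j₂ → ∀ x y : E, η j ![I • x, I • y] = η j ![x, y]) (hne : j₁ ≠ j₂)
    {h : E [⋀^Fin 2]→L[ℝ] ℝ} (hh : h ∈ realOneOneForms E) (hh0 : 0 < mixedIntersectionForm Φ e η hne h h)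
    (hHR : ∀ c ∈ realOneOneForms E, c ≠ 0 → mixedIntersectionForm Φ e η hne c h = 0 →
      mixedIntersectionForm Φ e η hne c c < 0)
    (h20 : ∀ a ∈ realTwoZeroForms E, a ≠ 0 → 0 < mixedIntersectionForm Φ e η hne a a) :
    sigPos (mixedIntersectionForm Φ e η hne).toQuadraticMap = 2 * g.choose 2 + 1 ∧
      sigNeg (mixedIntersectionForm Φ e η hne).toQuadraticMap = g * g - 1 ∧
        finrank ℝ ((mixedIntersectionForm Φ e η hne).toQuadraticMap.radical) = 0 := by
  have hg : 2 ≤ g := two_le_of_ne' hne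
  haveI := finiteDimensional_realForms Φ e (k := 2) (by omega)
  set QQ := (mixedIntersectionForm Φ e η hne).toQuadraticMap with hQQ
  have hhne : h ≠ 0 := fun h0 ↦ hh0.ne' (by rw [h0, LinearMap.map_zero₂])
  -- (1) the positive definite subspace `ℝh ⊕ (H^{2,0} ⊕ H^{0,2})_ℝ`
  have h1 : 2 * g.choose 2 + 1 ≤ sigPos QQ := by
    rw [← finrank_span_sup_realTwoZeroForms_eq Φ e (by omega) hh hhne]
    exact le_sigPos_of_posDef QQ
      (posDef_mixedIntersectionForm_restrict_span_sup_realTwoZeroForms_of_self_pos Φ e h11 hne hh hh0 h20)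
  -- (2) the negative definite `h`-primitive hyperplane `W ∩ h^⊥`
  have hN' : ((-QQ).restrict
      (realOneOneForms E ⊓ LinearMap.ker ((mixedIntersectionForm Φ e η hne).flip h))).PosDef := by
    rintro ⟨x, hx⟩ hx0
    have hx0' : x ≠ 0 := fun h0 ↦ hx0 (Subtype.ext h0)
    have hxh : mixedIntersectionForm Φ e η hne x h = 0 := by
      have := LinearMap.mem_ker.1 (Submodule.mem_inf.1 hx).2
      rwa [LinearMap.BilinForm.flip_apply] at this
    rw [QuadraticMap.restrict_apply, QuadraticMap.neg_apply, hQQ, LinearMap.BilinMap.toQuadraticMap_apply, neg_pos]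
    exact hHR x (Submodule.mem_inf.1 hx).1 hx0' hxh
  have h2 : g * g - 1 ≤ sigNeg QQ := by
    have hle := le_sigNeg_of_negDef QQ hN'
    have hdim := le_finrank_realOneOneForms_inf_ker_add_one Φ e hne h (η := η)
    omega
  -- (3) Sylvester's count
  have h3 := QuadraticForm.sigPos_add_sigNeg_add_radical (Q := QQ)
  rw [finrank_realForms_eq_choose Φ e 2, choose_two_mul_two_eq'] at h3
  have h5 : 1 ≤ g * g := le_trans (by norm_num) (Nat.mul_le_mul hg hg)
  omega

/-- **The degree-two mixed Hodge index theorem on the Hodge–Riemann locus: `(b⁺, b⁻)((· · · · 𝒞)) =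
(2·C(g,2) + 1, g² - 1) = (2h^{2,0}(X) + 1, h^{1,1}(X) - 1)` on `H²(X, ℝ)`** for every `(1,1)` background (semi-positive
or not) with `(h · h · 𝒞) > 0` for some `h ∈ H^{1,1}(X, ℝ)`, the Hodge–Riemann property on `W ∩ h^⊥` and
`(· · · · 𝒞) > 0` on `(H^{2,0} ⊕ H^{0,2})_ℝ ∖ 0` (for POSITIVE backgrounds all three hold and this is
`sigPos_sigNeg_mixedIntersectionForm`). [cite: DinhNguyen2006, §4 Proposition 4.1 and Remarks 4.2 (arXiv PDF p. 9)]
[cite: Huybrechts2005, Cor. 3.3.16] [cite: Timorin1998, Main Theorem and Corollary 2] -/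
theorem sigPos_sigNeg_mixedIntersectionForm_of_HR (e : Fin (2 * g) ≃ ι)
    (h11 : ∀ j, j ≠ j₁ → j ≠ j₂ → ∀ x y : E, η j ![I • x, I • y] = η j ![x, y]) (hne : j₁ ≠ j₂)
    {h : E [⋀^Fin 2]→L[ℝ] ℝ} (hh : h ∈ realOneOneForms E) (hh0 : 0 < mixedIntersectionForm Φ e η hne h h)
    (hHR : ∀ c ∈ realOneOneForms E, c ≠ 0 → mixedIntersectionForm Φ e η hne c h = 0 →
      mixedIntersectionForm Φ e η hne c c < 0)
    (h20 : ∀ a ∈ realTwoZeroForms E, a ≠ 0 → 0 < mixedIntersectionForm Φ e η hne a a) :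
    sigPos (mixedIntersectionForm Φ e η hne).toQuadraticMap = 2 * g.choose 2 + 1 ∧
      sigNeg (mixedIntersectionForm Φ e η hne).toQuadraticMap = g * g - 1 :=
  ⟨(index_aux_HR Φ e h11 hne hh hh0 hHR h20).1, (index_aux_HR Φ e h11 hne hh hh0 hHR h20).2.1⟩

/-- **The radical of `(· · · · 𝒞)` on `H²(X, ℝ)` is trivial on the Hodge–Riemann locus.**
[cite: DinhNguyen2006, §4 Proposition 4.1 and Remarks 4.2 (arXiv PDF p. 9)] -/
theorem radical_mixedIntersectionForm_eq_bot_of_HR (e : Fin (2 * g) ≃ ι)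
    (h11 : ∀ j, j ≠ j₁ → j ≠ j₂ → ∀ x y : E, η j ![I • x, I • y] = η j ![x, y]) (hne : j₁ ≠ j₂)
    {h : E [⋀^Fin 2]→L[ℝ] ℝ} (hh : h ∈ realOneOneForms E) (hh0 : 0 < mixedIntersectionForm Φ e η hne h h)
    (hHR : ∀ c ∈ realOneOneForms E, c ≠ 0 → mixedIntersectionForm Φ e η hne c h = 0 →
      mixedIntersectionForm Φ e η hne c c < 0)
    (h20 : ∀ a ∈ realTwoZeroForms E, a ≠ 0 → 0 < mixedIntersectionForm Φ e η hne a a) :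
    (mixedIntersectionForm Φ e η hne).toQuadraticMap.radical = ⊥ := by
  haveI := finiteDimensional_realForms Φ e (k := 2) (by have := two_le_of_ne' hne; omega)
  exact Submodule.finrank_eq_zero.1 (index_aux_HR Φ e h11 hne hh hh0 hHR h20).2.2

/-- **`(· · · · 𝒞)` is NON-DEGENERATE on `H²(X, ℝ)` on the Hodge–Riemann locus** ("if `[Ω] ∈ 𝒦^{HR}_{n-2}`, the
multiplication by `[Ω]` induces an isomorphism between `H²(X)` and `H^{2n-2}(X)`", Poincaré-dual form; here for
the closed cone `𝒦̃` with the `(2,0)`-definiteness as a hypothesis).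
[cite: DinhNguyen2006, §4 Remarks 4.2 (arXiv PDF p. 9)] [cite: VoisinHodgeI2002, §6.3.2 Thm. 6.33 (proof)] -/
theorem nondegenerate_mixedIntersectionForm_of_HR (e : Fin (2 * g) ≃ ι)
    (h11 : ∀ j, j ≠ j₁ → j ≠ j₂ → ∀ x y : E, η j ![I • x, I • y] = η j ![x, y]) (hne : j₁ ≠ j₂)
    {h : E [⋀^Fin 2]→L[ℝ] ℝ} (hh : h ∈ realOneOneForms E) (hh0 : 0 < mixedIntersectionForm Φ e η hne h h)
    (hHR : ∀ c ∈ realOneOneForms E, c ≠ 0 → mixedIntersectionForm Φ e η hne c h = 0 →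
      mixedIntersectionForm Φ e η hne c c < 0)
    (h20 : ∀ a ∈ realTwoZeroForms E, a ≠ 0 → 0 < mixedIntersectionForm Φ e η hne a a) :
    (mixedIntersectionForm Φ e η hne).Nondegenerate := by
  have hrad := radical_mixedIntersectionForm_eq_bot_of_HR Φ e h11 hne hh hh0 hHR h20
  refine (LinearMap.IsRefl.nondegenerate_iff_separatingLeft (isRefl_mixedIntersectionForm Φ e η hne)).2
    fun m hm ↦ ?_
  have hmem : m ∈ (mixedIntersectionForm Φ e η hne).toQuadraticMap.radical := by
    refine ⟨?_, ?_⟩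
    · change (mixedIntersectionForm Φ e η hne).toQuadraticMap m = 0
      rw [LinearMap.BilinMap.toQuadraticMap_apply]
      exact hm m
    · ext n
      rw [QuadraticMap.polarBilin_apply_apply, LinearMap.BilinMap.polar_toQuadraticMap, hm n,
        mixedIntersectionForm_comm_of_forms Φ e η hne n m, hm n, add_zero, LinearMap.zero_apply]
  rw [hrad] at hmem
  exact (Submodule.mem_bot ℝ).1 hmem

end HRLocus

/-! ## §3 `𝓛 ∩ 𝒦̃^{HR} = ∅` and its converse in degree two: non-degeneracy ⟺ Hodge–Riemann -/

section Degeneracy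

/-- **A semi-positive background with `(· · · · 𝒞)` non-degenerate on `H²(X, ℝ)` has the Hodge–Riemann property**
(the converse half of Prop. 4.1 in degree two: "`[Ω] ∉ 𝒦^{HR}` ⟹ there exists `c ∈ P^{1,1}(X)`, `c ≠ 0`, such
that `Q(c,c) = 0` ⟹ `Q(c,·) = 0` ⟹ `[Ω] ∈ 𝓛`"): for `0 ≠ c ∈ W ∩ h^⊥`, `(c · c · 𝒞) < 0`.
[cite: DinhNguyen2006, §4 Proposition 4.1 (proof) (arXiv PDF p. 9)] -/
theorem mixedIntersectionForm_self_neg_of_orthogonal_of_nondegenerate_of_semipos (e : Fin (2 * g) ≃ ι)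
    (h11 : ∀ j, j ≠ j₁ → j ≠ j₂ → ∀ x y : E, η j ![I • x, I • y] = η j ![x, y]) (hne : j₁ ≠ j₂)
    (hpsd : ∀ j, j ≠ j₁ → j ≠ j₂ → ∀ v : E, 0 ≤ η j ![I • v, v])
    (hnd : (mixedIntersectionForm Φ e η hne).Nondegenerate)
    {h c : E [⋀^Fin 2]→L[ℝ] ℝ} (hh : h ∈ realOneOneForms E) (hc : c ∈ realOneOneForms E)
    (hh0 : 0 < mixedIntersectionForm Φ e η hne h h) (hch : mixedIntersectionForm Φ e η hne c h = 0)
    (hc0 : c ≠ 0) : mixedIntersectionForm Φ e η hne c c < 0 := by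
  have hsep := (LinearMap.IsRefl.nondegenerate_iff_separatingLeft (isRefl_mixedIntersectionForm Φ e η hne)).1 hnd
  rcases (mixedIntersectionForm_self_nonpos_of_orthogonal_of_semipos Φ e h11 hne hpsd hh hc hh0 hch).lt_or_eq with
    hlt | heq
  · exact hlt
  · exact absurd (hsep c (mixedIntersectionForm_eq_zero_forall_of_semipos Φ e h11 hne hpsd hh hc hh0 hch heq)) hc0

/-- **A semi-positive background with `(· · · · 𝒞)` non-degenerate on `H²(X, ℝ)` is positive DEFINITE on
`(H^{2,0} ⊕ H^{0,2})_ℝ`** (it is `≥ 0` there, and a class of square zero would be a radical vector).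
[cite: DinhNguyen2006, §4 Proposition 4.1 (proof) and Remarks 4.2 (arXiv PDF p. 9)] [cite: Huybrechts2005, Cor. 3.3.16 (proof)] -/
theorem mixedIntersectionForm_self_pos_of_mem_realTwoZeroForms_of_nondegenerate_of_semipos (e : Fin (2 * g) ≃ ι)
    (h11 : ∀ j, j ≠ j₁ → j ≠ j₂ → ∀ x y : E, η j ![I • x, I • y] = η j ![x, y]) (hne : j₁ ≠ j₂)
    (hpsd : ∀ j, j ≠ j₁ → j ≠ j₂ → ∀ v : E, 0 ≤ η j ![I • v, v])
    (hnd : (mixedIntersectionForm Φ e η hne).Nondegenerate)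
    {a : E [⋀^Fin 2]→L[ℝ] ℝ} (ha : a ∈ realTwoZeroForms E) (ha0 : a ≠ 0) :
    0 < mixedIntersectionForm Φ e η hne a a := by
  have hsep := (LinearMap.IsRefl.nondegenerate_iff_separatingLeft (isRefl_mixedIntersectionForm Φ e η hne)).1 hnd
  rcases (mixedIntersectionForm_self_nonneg_of_mem_realTwoZeroForms_of_semipos Φ e h11 hne hpsd ha).lt_or_eq with
    hlt | heq
  · exact hlt
  · exact absurd (hsep a (mixedIntersectionForm_eq_zero_of_mem_realTwoZeroForms_of_self_eq_zero_of_semipos Φ e h11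
      hne hpsd ha heq.symm)) ha0

/-- **Prop. 4.1 in degree two on a complex torus: `𝓛 ∩ 𝒦̃^{HR} = ∅` and conversely** — for a SEMI-positive
background and a class `h ∈ H^{1,1}(X, ℝ)` with `(h · h · 𝒞) > 0`, `(· · · · 𝒞)` is NON-DEGENERATE on `H²(X, ℝ)`
**iff** the mixed Hodge–Riemann property holds on `W ∩ h^⊥` AND `(· · · · 𝒞) > 0` on `(H^{2,0} ⊕ H^{0,2})_ℝ ∖ 0`.
[cite: DinhNguyen2006, §4 Proposition 4.1 and Remarks 4.2 (arXiv PDF p. 9)] [cite: Huybrechts2005, Cor. 3.3.16] -/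
theorem nondegenerate_mixedIntersectionForm_iff_of_semipos (e : Fin (2 * g) ≃ ι)
    (h11 : ∀ j, j ≠ j₁ → j ≠ j₂ → ∀ x y : E, η j ![I • x, I • y] = η j ![x, y]) (hne : j₁ ≠ j₂)
    (hpsd : ∀ j, j ≠ j₁ → j ≠ j₂ → ∀ v : E, 0 ≤ η j ![I • v, v])
    {h : E [⋀^Fin 2]→L[ℝ] ℝ} (hh : h ∈ realOneOneForms E) (hh0 : 0 < mixedIntersectionForm Φ e η hne h h) :
    (mixedIntersectionForm Φ e η hne).Nondegenerate ↔
      (∀ c ∈ realOneOneForms E, c ≠ 0 → mixedIntersectionForm Φ e η hne c h = 0 →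
          mixedIntersectionForm Φ e η hne c c < 0) ∧
        ∀ a ∈ realTwoZeroForms E, a ≠ 0 → 0 < mixedIntersectionForm Φ e η hne a a :=
  ⟨fun hnd ↦ ⟨fun _ hc hc0 hch ↦ mixedIntersectionForm_self_neg_of_orthogonal_of_nondegenerate_of_semipos Φ e h11
      hne hpsd hnd hh hc hh0 hch hc0,
    fun _ ha ha0 ↦ mixedIntersectionForm_self_pos_of_mem_realTwoZeroForms_of_nondegenerate_of_semipos Φ e h11 hne
      hpsd hnd ha ha0⟩,
    fun hp ↦ nondegenerate_mixedIntersectionForm_of_HR Φ e h11 hne hh hh0 hp.1 hp.2⟩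

/-- **Non-degeneracy on `H²` forces non-degeneracy on `H^{1,1}`** (semi-positive background, `(h · h · 𝒞) > 0`):
by g23-#4's `nondegenerate_mixedIntersectionForm_restrict_realOneOneForms_iff_of_semipos`.
[cite: DinhNguyen2006, §4 Proposition 4.1 (arXiv PDF p. 9)] -/
theorem nondegenerate_mixedIntersectionForm_restrict_of_nondegenerate_of_semipos (e : Fin (2 * g) ≃ ι)
    (h11 : ∀ j, j ≠ j₁ → j ≠ j₂ → ∀ x y : E, η j ![I • x, I • y] = η j ![x, y]) (hne : j₁ ≠ j₂)
    (hpsd : ∀ j, j ≠ j₁ → j ≠ j₂ → ∀ v : E, 0 ≤ η j ![I • v, v])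
    {h : E [⋀^Fin 2]→L[ℝ] ℝ} (hh : h ∈ realOneOneForms E) (hh0 : 0 < mixedIntersectionForm Φ e η hne h h)
    (hnd : (mixedIntersectionForm Φ e η hne).Nondegenerate) :
    ((mixedIntersectionForm Φ e η hne).restrict (realOneOneForms E)).Nondegenerate :=
  (nondegenerate_mixedIntersectionForm_restrict_realOneOneForms_iff_of_semipos Φ e h11 hne hpsd hh hh0).2
    ((nondegenerate_mixedIntersectionForm_iff_of_semipos Φ e h11 hne hpsd hh hh0).1 hnd).1

/-- **Signature form of Prop. 4.1 in degree two**: for a semi-positive background with `(h · h · 𝒞) > 0`,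
`(· · · · 𝒞)` is non-degenerate on `H²(X, ℝ)` iff `(b⁺, b⁻) = (2·C(g,2) + 1, g² - 1)` (`b⁺ + b⁻ + dim rad = C(2g,2)`).
[cite: DinhNguyen2006, §4 Proposition 4.1 and Remarks 4.2 (arXiv PDF p. 9)] [cite: Huybrechts2005, Cor. 3.3.16] -/
theorem nondegenerate_mixedIntersectionForm_iff_sigPos_sigNeg_of_semipos (e : Fin (2 * g) ≃ ι)
    (h11 : ∀ j, j ≠ j₁ → j ≠ j₂ → ∀ x y : E, η j ![I • x, I • y] = η j ![x, y]) (hne : j₁ ≠ j₂)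
    (hpsd : ∀ j, j ≠ j₁ → j ≠ j₂ → ∀ v : E, 0 ≤ η j ![I • v, v])
    {h : E [⋀^Fin 2]→L[ℝ] ℝ} (hh : h ∈ realOneOneForms E) (hh0 : 0 < mixedIntersectionForm Φ e η hne h h) :
    (mixedIntersectionForm Φ e η hne).Nondegenerate ↔
      sigPos (mixedIntersectionForm Φ e η hne).toQuadraticMap = 2 * g.choose 2 + 1 ∧
        sigNeg (mixedIntersectionForm Φ e η hne).toQuadraticMap = g * g - 1 := by
  have hg : 2 ≤ g := two_le_of_ne' hne
  haveI := finiteDimensional_realForms Φ e (k := 2) (by omega)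
  constructor
  · intro hnd
    obtain ⟨hHR, h20⟩ := (nondegenerate_mixedIntersectionForm_iff_of_semipos Φ e h11 hne hpsd hh hh0).1 hnd
    exact sigPos_sigNeg_mixedIntersectionForm_of_HR Φ e h11 hne hh hh0 hHR h20
  · rintro ⟨hp, hn⟩
    -- `b⁺ + b⁻ = C(2g, 2)` forces `rad = ⊥`
    have h3 := QuadraticForm.sigPos_add_sigNeg_add_radical (Q := (mixedIntersectionForm Φ e η hne).toQuadraticMap)
    rw [finrank_realForms_eq_choose Φ e 2, choose_two_mul_two_eq', hp, hn] at h3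
    have h5 : 1 ≤ g * g := le_trans (by norm_num) (Nat.mul_le_mul hg hg)
    have hrad0 : finrank ℝ ((mixedIntersectionForm Φ e η hne).toQuadraticMap.radical) = 0 := by omega
    have hrad : (mixedIntersectionForm Φ e η hne).toQuadraticMap.radical = ⊥ := Submodule.finrank_eq_zero.1 hrad0
    refine (LinearMap.IsRefl.nondegenerate_iff_separatingLeft (isRefl_mixedIntersectionForm Φ e η hne)).2
      fun m hm ↦ ?_
    have hmem : m ∈ (mixedIntersectionForm Φ e η hne).toQuadraticMap.radical := by
      refine ⟨?_, ?_⟩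
      · change (mixedIntersectionForm Φ e η hne).toQuadraticMap m = 0
        rw [LinearMap.BilinMap.toQuadraticMap_apply]
        exact hm m
      · ext n
        rw [QuadraticMap.polarBilin_apply_apply, LinearMap.BilinMap.polar_toQuadraticMap, hm n,
          mixedIntersectionForm_comm_of_forms Φ e η hne n m, hm n, add_zero, LinearMap.zero_apply]
    rw [hrad] at hmem
    exact (Submodule.mem_bot ℝ).1 hmem

/-- **Positive backgrounds lie in the Hodge–Riemann locus** (consistency with `ComplexTorusMixedHodgeIndexDegreeTwo`:
for a POSITIVE background the hypotheses of §2 hold with `h` any positive `(1,1)`-form, so the present theorems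
specialise to the tree's `sigPos_sigNeg_mixedIntersectionForm` / `nondegenerate_mixedIntersectionForm`).
[cite: DinhNguyen2006, §1 Theorem 1.3 and §4 Remarks 4.2 (arXiv PDF pp. 3, 9)] [cite: Huybrechts2005, §3.1 Examples 3.1.9 ii)] -/
theorem exists_HR_of_pos (e : Fin (2 * g) ≃ ι)
    (h11 : ∀ j, j ≠ j₁ → j ≠ j₂ → ∀ x y : E, η j ![I • x, I • y] = η j ![x, y]) (hne : j₁ ≠ j₂)
    (hpos : ∀ j, j ≠ j₁ → j ≠ j₂ → ∀ v : E, v ≠ 0 → 0 < η j ![I • v, v]) :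
    ∃ h ∈ realOneOneForms E, 0 < mixedIntersectionForm Φ e η hne h h ∧
      (∀ c ∈ realOneOneForms E, c ≠ 0 → mixedIntersectionForm Φ e η hne c h = 0 →
          mixedIntersectionForm Φ e η hne c c < 0) ∧
        ∀ a ∈ realTwoZeroForms E, a ≠ 0 → 0 < mixedIntersectionForm Φ e η hne a a := by
  obtain ⟨ω, hω11, hωpos⟩ := exists_pos_typeOneOne Φ
  have hω : ω ∈ realOneOneForms E := mem_realOneOneForms_of_I_smul hω11
  have hω0 : 0 < mixedIntersectionForm Φ e η hne ω ω := mixedIntersectionForm_self_pos_of_pos' Φ e h11 hne hpos hω11 hωpos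
  exact ⟨ω, hω, hω0, fun c hc hc0 hch ↦
    mixedIntersectionForm_self_neg_of_orthogonal_of_self_pos Φ e h11 hne hpos hω hc hω0 hch hc0,
    fun a ha ha0 ↦ mixedIntersectionForm_self_pos_of_mem_realTwoZeroForms Φ e h11 hne hpos ha ha0⟩

end Degeneracy

end ComplexTorus

end Literature.Geometry.Kaehler

end
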